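import Literature.NumberTheory.EllipticCurves.IwasawaSelmerSupersingularLocalProofs
import Literature.NumberTheory.EllipticCurves.SelmerGaloisActionPlaces
import HarnessLib

/-!
# The Galois transport of completions and its lifts are isometries of the spectral valuations
# (theorems only; no definition, no named fact, no instance, no `sorry`)

Topic `NumberTheory/EllipticCurves` (local bookkeeping for the D1 road of cell `pub/bsd-print-x9`: transport of the kernel of
reduction `E₁(K̄_v)` between conjugate places, Howard 2004 §1.3 «conjugation by `τ` … `v̄ = v^τ`»).

For a number field `K`, `σ ∈ Aut(K/F)` and finite places with `σ • w = v`, the Galois transport of completions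
`θ = galAdicCompletionEquiv σ _ : K_w ≃+* K_v` (Cassels–Fröhlich VII §1.1) preserves the normalised absolute values
(`valued_galAdicCompletionMap` and `N(σ • w) = N(w)`, tree `absNorm_algEquiv_smul`), and therefore EVERY lift
`Θ : K̄_w ≃+* K̄_v` of `θ` (`IsLiftOfRingEquiv`) is an isometry of the spectral valuations (the unique extensions; Neukirch,
*ANT* II (4.8)): `|Θ z|_v = |z|_w` — the minimal polynomial of `Θ z` over `K_v` is the `θ`-image of that of `z` over `K_w`, and the
spectral value of a polynomial only sees the absolute values of its coefficients.

* `norm_galAdicCompletionEquiv` — `‖θ c‖_v = ‖c‖_w`;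
* `spectralValue_map_of_norm_map` — `spectralValue (p.map φ) = spectralValue p` for a norm-preserving injective `φ`;
* `minpoly_map_of_isLiftOfRingEquiv` — `minpoly K_v (Θ z) = (minpoly K_w z).map θ`;
* **`spectralNorm_ringEquivLift_eq`** / **`spectralValuation_apply_lift_eq`** — `|Θ z|_v = |z|_w` for any lift `Θ` of `θ`, in
  particular for `ringEquivLift θ`; `lift_mem_localAbsIntegers_iff`-type corollaries (`Θ` preserves `|·| ≤ 1`, `|·| < 1`, `|·| > 1`).

References: [CasselsFrohlichANT1967] Ch. VII (Tate) §1.1; [NeukirchANT1999] Ch. II Thm. (4.8) (uniqueness of the extended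
valuation); [SerreGaloisCohomology1997] II.§1.1. BSD is not proved by any of this.
-/

noncomputable section

open scoped NNReal
open NumberField IsDedekindDomain Field Polynomial

namespace IsDedekindDomain.HeightOneSpectrum

open Literature.NumberTheory.EllipticCurves Literature.NumberTheory.Automorphic

universe u

variable {K : Type u} [Field K] [NumberField K]

/-! ## §1 `θ = galAdicCompletionEquiv σ _` preserves the normalised absolute value -/

/-- **`‖σ_w c‖_v = ‖c‖_w`** for the Galois transport `σ_w : K_w → K_v` of completions (`σ • w = v`): it preserves the
`ℤ`-valued valuations (`valued_galAdicCompletionMap`) and the residue cardinalities `N(v) = N(w)` normalising the absolute values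
(`absNorm_algEquiv_smul`). [cite: CasselsFrohlichANT1967, Ch. VII §1.1 («σ induces by continuity an isomorphism σ_w : L_w → L_{σw}»)] -/
theorem norm_galAdicCompletionMap {F : Type*} [Field F] [Algebra F K] (σ : K ≃ₐ[F] K) {w v : HeightOneSpectrum (𝓞 K)}
    (h : σ • w = v) (c : w.adicCompletion K) : ‖galAdicCompletionMap (L := K) σ h c‖ = ‖c‖ := by
  rw [NumberField.FinitePlace.norm_def, NumberField.FinitePlace.norm_def, valued_galAdicCompletionMap]
  have hN : (Ideal.absNorm v.asIdeal : ℝ≥0) = Ideal.absNorm w.asIdeal := by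
    rw [← h, HeightOneSpectrum.absNorm_algEquiv_smul]
  rcases eq_or_ne (Valued.v c) 0 with h0 | h0
  · rw [h0, map_zero, map_zero]
  · rw [WithZeroMulInt.toNNReal_neg_apply _ h0, WithZeroMulInt.toNNReal_neg_apply _ h0, hN]

/-- The same for `galAdicCompletionEquiv`. [cite: CasselsFrohlichANT1967, Ch. VII §1.1] -/
theorem norm_galAdicCompletionEquiv {F : Type*} [Field F] [Algebra F K] (σ : K ≃ₐ[F] K) {w v : HeightOneSpectrum (𝓞 K)}
    (h : σ • w = v) (c : w.adicCompletion K) : ‖galAdicCompletionEquiv (L := K) σ h c‖ = ‖c‖ :=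
  norm_galAdicCompletionMap σ h c

end IsDedekindDomain.HeightOneSpectrum

/-! ## §2 Spectral values and minimal polynomials along a norm-preserving isomorphism -/

namespace Literature.NumberTheory.EllipticCurves

section Spectral

variable {E E' : Type*} [NormedField E] [NormedField E'] (φ : E →+* E') (hφ : ∀ c, ‖φ c‖ = ‖c‖)

include hφ in
/-- **The spectral value only sees the absolute values of the coefficients**: `spectralValue (p.map φ) = spectralValue p` for a
ring homomorphism of normed fields with `‖φ c‖ = ‖c‖`. [cite: NeukirchANT1999, Ch. II §4 (the spectral value / Newton polygon)] -/
theorem spectralValue_map_of_norm_map (p : E[X]) : spectralValue (p.map φ) = spectralValue p := by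
  unfold spectralValue
  have hdeg : (p.map φ).natDegree = p.natDegree := natDegree_map_eq_of_injective φ.injective p
  congr 1
  funext i
  simp only [spectralValueTerms, hdeg, coeff_map, hφ]

end Spectral

section Lift

universe v

variable {E E' : Type v} [Field E] [Field E'] {θ : E ≃+* E'}
  {Θ : AlgebraicClosure E ≃+* AlgebraicClosure E'}

/-- For a lift `Θ` of `θ` (`Θ ∘ ι_E = ι_{E'} ∘ θ`): `aeval (Θ z) (p.map θ) = Θ (aeval z p)`.
[cite: SerreGaloisCohomology1997, II.§1.1] -/
theorem aeval_lift_map_eq (hΘ : IsLiftOfRingEquiv θ Θ) (p : E[X]) (z : AlgebraicClosure E) :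
    aeval (Θ z) (p.map (θ : E →+* E')) = Θ (aeval z p) := by
  rw [aeval_def, eval₂_map, aeval_def]
  change _ = (Θ : AlgebraicClosure E →+* AlgebraicClosure E') (eval₂ _ z p)
  rw [hom_eval₂]
  congr 1
  ext c
  exact (hΘ c).symm

/-- **`minpoly E' (Θ z) = (minpoly E z).map θ`** for a lift `Θ : Ē ≃+* Ē'` of a field isomorphism `θ : E ≃+* E'` (the image of
the minimal polynomial is monic, irreducible and vanishes at `Θ z`). [cite: SerreGaloisCohomology1997, II.§1.1] -/
theorem minpoly_lift_eq_map (hΘ : IsLiftOfRingEquiv θ Θ) (z : AlgebraicClosure E) :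
    minpoly E' (Θ z) = (minpoly E z).map (θ : E →+* E') := by
  have hz : IsIntegral E z := Algebra.IsIntegral.isIntegral z
  symm
  refine minpoly.eq_of_irreducible_of_monic ?_ ?_ ((minpoly.monic hz).map _)
  · have h := (minpoly.irreducible hz)
    exact (MulEquiv.irreducible_iff (Polynomial.mapEquiv θ)).mpr h
  · rw [aeval_lift_map_eq hΘ, minpoly.aeval, map_zero]

end Lift

end Literature.NumberTheory.EllipticCurves

/-! ## §3 Lifts of the Galois transport are isometries of the spectral valuations -/

namespace IsDedekindDomain.HeightOneSpectrum

open Literature.NumberTheory.EllipticCurves Literature.NumberTheory.Automorphic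

universe u

variable {K : Type u} [Field K] [NumberField K] {F : Type*} [Field F] [Algebra F K] (σ : K ≃ₐ[F] K)
  {w v : HeightOneSpectrum (𝓞 K)} (h : σ • w = v)
  {Θ : AlgebraicClosure (w.adicCompletion K) ≃+* AlgebraicClosure (v.adicCompletion K)}

/-- **`spectralNorm K_v K̄_v (Θ z) = spectralNorm K_w K̄_w z`** for every lift `Θ` of the Galois transport `K_w ≃+* K_v`: the spectral
norm is the spectral value of the minimal polynomial, transported by the norm-preserving `θ`.
[cite: NeukirchANT1999, Ch. II Thm. (4.8) (uniqueness of the extension of the absolute value)] [cite: CasselsFrohlichANT1967, Ch. VII §1.1] -/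
theorem spectralNorm_lift_galAdicCompletionEquiv_eq (hΘ : IsLiftOfRingEquiv (galAdicCompletionEquiv (L := K) σ h) Θ)
    (z : AlgebraicClosure (w.adicCompletion K)) :
    spectralNorm (v.adicCompletion K) (AlgebraicClosure (v.adicCompletion K)) (Θ z) =
      spectralNorm (w.adicCompletion K) (AlgebraicClosure (w.adicCompletion K)) z := by
  unfold spectralNorm
  rw [minpoly_lift_eq_map hΘ]
  exact spectralValue_map_of_norm_map _ (norm_galAdicCompletionEquiv σ h) _

/-- **`|Θ z|_v = |z|_w`**: every lift of the Galois transport of completions is an isometry of the spectral valuations of the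
tree (`spectralValuation`, pinned to the spectral norm by `coe_spectralValuation`). [cite: NeukirchANT1999, Ch. II Thm. (4.8)]
[cite: CasselsFrohlichANT1967, Ch. VII §1.1] -/
theorem spectralValuation_lift_galAdicCompletionEquiv_eq (hΘ : IsLiftOfRingEquiv (galAdicCompletionEquiv (L := K) σ h) Θ)
    (z : AlgebraicClosure (w.adicCompletion K)) : v.spectralValuation (Θ z) = w.spectralValuation z := by
  apply NNReal.coe_injective
  rw [coe_spectralValuation, coe_spectralValuation]
  exact spectralNorm_lift_galAdicCompletionEquiv_eq σ h hΘ z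

/-- The chosen lift `ringEquivLift` of the Galois transport is an isometry of the spectral valuations.
[cite: NeukirchANT1999, Ch. II Thm. (4.8)] [cite: CasselsFrohlichANT1967, Ch. VII §1.1] -/
theorem spectralValuation_ringEquivLift_galAdicCompletionEquiv_eq (z : AlgebraicClosure (w.adicCompletion K)) :
    v.spectralValuation (ringEquivLift (galAdicCompletionEquiv (L := K) σ h) z) = w.spectralValuation z :=
  spectralValuation_lift_galAdicCompletionEquiv_eq σ h (isLiftOfRingEquiv_ringEquivLift _) z

end IsDedekindDomain.HeightOneSpectrum

end
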